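import Mathlib
import Summits.ValiantsHypothesis.ValiantsHypothesis.Theses.BarrierLever
import Summits.ValiantsHypothesis.ValiantsHypothesis.Theorems.BarrierLeverPrincipalMinorLayoutsNonsingularSuffices
import Summits.ValiantsHypothesis.ValiantsHypothesis.Theorems.BarrierLeverPrincipalMinorLayoutsSymmetricCauchyKernel

/-!
# Route BarrierLever — items `PrincipalMinorLayoutsNonsingular` (stmt-ValiantsHypothesis-19126) and
# `PartitionMinorsHitByVP` (stmt-ValiantsHypothesis-19717): the SYMMETRIC CAUCHY WITNESS

Helper file (`--supports stmt-ValiantsHypothesis-19717`; cell valiant-natproofs, rung V4, 𝒟-side of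
FSV18 Question 6; prover seat val-np-p3 gen 4). Definition-free. Closes NO item. Part 3 of 3 — the thin GLUE inside the theses cone: part 1
(`…SymmetricCauchyMinors`) has the Cauchy principal-minor identities `det_cauchy_principal`,
`det_cauchy_principal_union`, `tns_entry_cauchy`, `tns_det_cauchy`; part 2
(`…SymmetricCauchyKernel`, cone-free) has `kernel_divFree_eq`, `exists_generic_kernel_witness` and
`tns_layout_of_kernel` (item 19126 one layout at a time from the kernel hypothesis).

**Setting.** TNS (`Theses.BarrierLever.PrincipalMinorLayoutsNonsingular`, stmt-19126) asks, for every
square layout `u, w : Fin r → Finset (Fin h)` (injective), for a matrix `K ∈ ℂ^{(h+h)×(h+h)}` whose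
principal-minor layout matrix `(det K[u_i ⊔ w̄_j])_{i,j}` is nonsingular (`u_i` read in the first
`h` indices, `w̄_j` in the last `h`); by the tree's universal-witness arrow
(`PrincipalMinorWitness.principalMinorLayoutsNonsingularSuffices`, item 19133, `b = 8`) TNS implies
`PartitionMinorsHitByVP` (stmt-19717). The cell's witness families so far are the GENERIC `K`
(`4h²` parameters; exhaustive evidence `h ≤ 4`) and, on the transversal side, the resultant kernel CT
(stmt-19179, `4h` parameters).

**This file: a `2h`-parameter witness with EXPLICIT entries.** Take `K` to be the SYMMETRIC CAUCHY
MATRIX `K = ((θ_i + θ_j)⁻¹)_{i,j < h+h}`, `θ = (s, t)` (`s` on the x-indices, `t` on the y-indices).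
By Cauchy's double alternant (tree `Literature.LinearAlgebra.Matrix.det_cauchyMatrix`) every
principal minor is a product over pairs,
`det K[S] = ∏_{i<j ∈ S} (θ_j - θ_i)² / ∏_{i,j ∈ S} (θ_i + θ_j)` (`det_cauchy_principal`), so the
principal minors are PAIRWISE MULTIPLICATIVE:
`det K[A ⊔ B] = det K[A] · det K[B] · ∏_{a ∈ A, b ∈ B} ((θ_a - θ_b)/(θ_a + θ_b))²`
(`det_cauchy_principal_union`). Hence the TNS layout matrix FACTORISES
(`tns_entry_cauchy`, `tns_det_cauchy`):
`det K[u_i ⊔ w̄_j] = R(u_i) · C(w_j) · ∏_{a ∈ u_i} ∏_{c ∈ w_j} ((s_a - t_c)/(s_a + t_c))²`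
with `R(u) = det K[u-part] ≠ 0`, `C(w) = det K[w-part] ≠ 0` (injective `s`, `t`;
`det_cauchy_principal_ne_zero`), i.e. up to invertible diagonal factors it is the KERNEL MATRIX
`N[u, w] = ∏_{a ∈ u, c ∈ w} ((s_a - t_c)/(s_a + t_c))²`, or, division-free (row factors
`∏_{a ∈ u} ∏_c (s_a + t_c)²`, `kernel_divFree_eq`),
`N'[u, w] = ∏_{a ∈ u} ∏_{c < h} (s_a ∓ t_c)²` (sign `-` iff `c ∈ w`) `= Res(P_u, Q_w^±)²`,
the SQUARE of the resultant of `P_u(z) = ∏_{a ∈ u} (z - s_a)` and `Q_w^±(z) = ∏_c (z ∓ t_c)`.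

* `tns_layout_of_kernel` — ONE LAYOUT AT A TIME: if `det (N'[u_i, w_j]) ≠ 0` for SOME `(s, t)`
  then (Zariski genericity, `exists_generic_kernel_witness`: move to `(s, t)` with all
  `s_a + s_{a'}, t_c + t_{c'}, s_a + t_c ≠ 0` and `s, t` injective) the TNS layout matrix of the
  symmetric Cauchy `K` is nonsingular.
* `principalMinorLayoutsNonsingular_of_symmetricCauchy` — the SYMMETRIC CAUCHY KERNEL CONJECTURE
  «SCK: for every injective layout some `(s, t) ∈ ℂ^h × ℂ^h` has `det (N'[u_i, w_j])_{i,j} ≠ 0`»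
  implies `Theses.BarrierLever.PrincipalMinorLayoutsNonsingular` (stmt-19126);
* `partitionMinorsHitByVP_of_symmetricCauchy` — SCK implies `Theses.BarrierLever.PartitionMinorsHitByVP`
  (stmt-19717), the witness polynomial being `det(1 + diag(x, y)·K)`, `K` symmetric Cauchy.

EVIDENCE for SCK (census of this seat, scripts `census/kernel_screen.py`, `census/kb_struct.py`,
kit jobs `sc-kernel-exh-h4-*` attached to stmt-19126): exhaustive `h = 3` (all 12 869 square layouts),
`h = 4` exhaustive for `r ≤ 3` and `r ≥ 13` plus 20 000 random mid-band layouts, structured batteries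
(twins `2^D × 2^{Dᶜ}`, `k`-sets vs `k'`-sets, parity classes, even cycles, complements, random
mid-band and co-small) for `h = 4, …, 8`: NO singular layout. By contrast the UNSQUARED kernels
`∏ (s_a - t_c)` (the all-subsets resultant kernel, p1-g8 `sct_test.py`) and `∏ (s_a + t_c)/(s_a - t_c)`
die already at `h = 3` (affine / Möbius dependences among singleton rows), and so do the
restricted TNS families `K = [[1, B], [C, 1]]` (generic `B, C`) and `B` triangular.

WHY IT MATTERS. (i) It is the smallest explicit TNS witness family (`2h` parameters, closed-form
entries); (ii) the kernel is `exp` of a bilinear form in power-sum features,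
`N[u, w] = exp(4 Σ_{m odd} m⁻¹ p_m(σ_u) p_m(τ_w))` (`σ = 1/s`), a Schur-`Q` Cauchy kernel, so the
layout determinant is open to symmetric-function / total-positivity / tropical (`t → 0`: generalised
Vandermonde corner; `s_a ≈ t_c`: product-state and tree-profit corners) attacks that the generic
`K` does not offer.

WHAT THIS IS NOT: SCK is a CONJECTURE (a `2h`-parameter strengthening of TNS); nothing here is
unconditional on the middle band of item 19717; nothing on TT / CT, on crux stmt-14610 (FSV18
Question 6) or on `VP` vs `VNP`.

References: A.-L. Cauchy (1841) / [Krattenthaler1999] eq. (2.7) (double alternant); N. Nisan, STOC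
1991 (partition matrices); [ForbesShpilkaVolk2018] §8, Question 6; I. G. Macdonald, Symmetric
functions and Hall polynomials, III.8 (Schur `Q`-function Cauchy identity).
-/

set_option linter.dupNamespace false

open Finset Matrix

namespace Summit.ValiantsHypothesis.ValiantsHypothesis.Theorems.BarrierLever.SymmetricCauchy

/-- **The symmetric Cauchy kernel conjecture implies TNS** (item `PrincipalMinorLayoutsNonsingular`,
stmt-ValiantsHypothesis-19126): if for every injective layout `(u, w)` the `2h`-parameter kernel
matrix `(∏_{a ∈ u_i} ∏_{c < h} (s_a ∓_{[c ∈ w_j]} t_c)²)_{i,j}` is nonsingular for some `s, t ∈ ℂ^h`,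
then every principal-minor layout matrix is nonsingular for some `K` — namely the symmetric Cauchy
matrix `K = ((θ_i + θ_j)⁻¹)`, `θ = (s, t)` in general position. -/
theorem principalMinorLayoutsNonsingular_of_symmetricCauchy
    (hSC : ∀ (h r : ℕ) (u w : Fin r → Finset (Fin h)), Function.Injective u →
      Function.Injective w → ∃ s t : Fin h → ℂ, (Matrix.of fun i j : Fin r =>
        ∏ a ∈ u i, ∏ c : Fin h, (if c ∈ w j then s a - t c else s a + t c) ^ 2).det ≠ 0) :
    Summit.ValiantsHypothesis.ValiantsHypothesis.Theses.BarrierLever.PrincipalMinorLayoutsNonsingular := by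
  intro h r u w hu hw
  exact tns_layout_of_kernel h r u w (hSC h r u w hu hw)

/-- **The symmetric Cauchy kernel conjecture implies `PartitionMinorsHitByVP`**
(stmt-ValiantsHypothesis-19717), through the universal-witness arrow of item
`PrincipalMinorLayoutsNonsingularSuffices` (tree theorem
`PrincipalMinorWitness.principalMinorLayoutsNonsingularSuffices`, `b = 8`): the witness polynomial
is `det(1 + diag(x, y)·K)` for the symmetric Cauchy matrix `K`. -/
theorem partitionMinorsHitByVP_of_symmetricCauchy
    (hSC : ∀ (h r : ℕ) (u w : Fin r → Finset (Fin h)), Function.Injective u →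
      Function.Injective w → ∃ s t : Fin h → ℂ, (Matrix.of fun i j : Fin r =>
        ∏ a ∈ u i, ∏ c : Fin h, (if c ∈ w j then s a - t c else s a + t c) ^ 2).det ≠ 0) :
    Summit.ValiantsHypothesis.ValiantsHypothesis.Theses.BarrierLever.PartitionMinorsHitByVP :=
  PrincipalMinorWitness.principalMinorLayoutsNonsingularSuffices
    (principalMinorLayoutsNonsingular_of_symmetricCauchy hSC)

end Summit.ValiantsHypothesis.ValiantsHypothesis.Theorems.BarrierLever.SymmetricCauchy
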